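import Literature.Probability.LatticeModels.LatticeSineGordonCompact

/-! Candidate registered form DS_compact of `stub_debyeScreening` (crux AnchorGap) over the landed compact model (p156764). -/

open MeasureTheory Literature.Probability.LatticeModels

/-- DS_compact (candidate; OPEN). -/
theorem stub_debyeScreening_compact_candidate :
    ∀ (k M : ℕ) (α : Fin M → Fin k → ℝ), (∀ v : Fin k → ℝ, (∀ r : Fin M, ∑ a : Fin k, α r a * v a = 0) → v = 0) → ∀ (b : Fin k → Fin k → ℝ), LinearIndependent ℝ b → (∀ (j : Fin k) (r : Fin M), ∃ z : ℤ, ∑ a : Fin k, α r a * b j a = 2 * Real.pi * z) → ∀ g₁ g₂ : ℝ, 0 < g₁ → g₁ ≤ g₂ → ∃ ζ₀ : ℝ, 0 < ζ₀ ∧ ∀ ζ₁ : ℝ, 0 < ζ₁ → ζ₁ ≤ ζ₀ → ∀ R₀ : ℕ, ∃ C c : ℝ, 0 < c ∧ ∃ n₀ : ℕ, ∀ (N : ℕ) [NeZero N], ∀ g ζ : ℝ, g₁ ≤ g → g ≤ g₂ → ζ₁ ≤ ζ → ζ ≤ ζ₀ → let Obs := fun F : LatticeSineGordon.Config 3 N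 k → ℝ => Measurable F ∧ (∀ φ, |F φ| ≤ 1) ∧ (∀ φ ψ : LatticeSineGordon.Config 3 N k, (∀ x : TorusSite 3 N, (∀ i : Fin 3, (x i).val ≤ R₀) → ∀ a : Fin k, φ (x, a) = ψ (x, a)) → F φ = F ψ) ∧ (∀ (φ : LatticeSineGordon.Config 3 N k) (x : TorusSite 3 N) (w : Fin k → ℝ), (∀ r : Fin M, ∃ z : ℤ, ∑ a : Fin k, α r a * w a = 2 * Real.pi * z) → F (fun p => if p.1 = x then φ p + w p.2 else φ p) = F φ); ∀ F G : LatticeSineGordon.Config 3 N k → ℝ, Obs F → Obs G → ∀ n : ℕ, n₀ < n → 2 * n < N → |LatticeSineGordon.compactTruncCorr b α g ζ F (fun φ => G (fun p => φ (p.1 + Pi.single 0 (n : ZMod N), p.2)))| ≤ C * Real.exp (-(c * n)) := by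
  sorry
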